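import Literature.Computability.AlgebraicComplexity.LRFullLifts
import Literature.Computability.AlgebraicComplexity.DetReprEquivalent

/-!
# Crux `ProjectionStability.OptStep` (stmt-ValiantsHypothesis-17835), line `Sketch` —
# registered stub `stub_halfEq_transport_symm`

**Transport of half-equivariance along the realised symmetries of `per_k`.**
Write `L = leftMonomialSubst ℂ k` (substitutions `x ↦ (g ⊗ 1) x`, `g` monomial),
`R = rightMonomialSubst ℂ k` (`x ↦ (1 ⊗ h) x`), `τ` for the unique element of
`transposeSubstSet ℂ k` (the permutation matrix of `Prod.swap`, i.e. `x ↦ xᵀ`), and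
`S = permSymmetrySubst ℂ k = closure (L ∪ R ∪ {τ})` (Landsberg–Ressayre 2017, §2.1).
Call a square matrix `M` of polynomials *`L`-liftable* when every `λ ∈ L` lifts exactly,
`M(λ·x) = P · M · Q` with constant invertible `P, Q`, and *half-liftable* when `M` or
`M(τ·x) = M.map (rename Prod.swap)` is `L`-liftable.

Main statement (`stub_halfEq_transport_symm`, the registered signature): if `A` or
`A.map (rename Prod.swap)` is an exactly-lifted `L`-equivariant affine determinantal representation
of `per_k`, `γ ∈ S`, and `det A(γ·x) = per_k`, then `A(γ·x)` or its variable-transpose is an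
exactly-lifted `L`-equivariant representation of `per_k`.

Proof.
* Group structure (§2.1 of LR17, proved here from the definitions):
  `L` and `R` commute elementwise (`(g ⊗ 1)(1 ⊗ h) = g ⊗ h = (1 ⊗ h)(g ⊗ 1)`, extended to the
  closures through `Subgroup.centralizer_closure`); `τ² = 1`; `τ (g ⊗ h) τ = h ⊗ g`, hence
  `τ L τ⁻¹ ⊆ R` and `τ R τ⁻¹ ⊆ L` (closure induction).
* Transport of `L`-lifts: along `ℓ ∈ L` (tree lemma `forall_exists_lift_linSubstEntries`), along
  `r ∈ R` (`r` centralises `L`: `M(r·x)(λ·x) = M(λ·x)(r·x) = P · M(r·x) · Q`), and the twisted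
  versions `M(ℓ·x)(τ·x) = M(τ·x)((τ ℓ τ⁻¹)·x)` with `τ ℓ τ⁻¹ ∈ R`, resp. `τ r τ⁻¹ ∈ L`; `τ` itself
  swaps the two disjuncts of half-liftability (`M(τ·x)(τ·x) = M`). A closure induction over
  `S = closure (L ∪ R ∪ {τ})` then shows that every `γ ∈ S` preserves half-liftability.
* The determinant is kept out of the induction (scalings in `L` change it by a unit) and restored
  at the end from the hypothesis `det A(γ·x) = per_k`, using `rename Prod.swap per_k = per_k`
  (`per (Xᵀ) = per X`) for the twisted disjunct; degrees `≤ 1` are preserved by substitutions.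

Unconditional (no named facts). References: J. M. Landsberg, N. Ressayre, Differential Geom.
Appl. 55 (2017), §2.1, Def. 1.3.
-/

-- layout Summits/ValiantsHypothesis/ValiantsHypothesis forces the duplicated namespace component
set_option linter.dupNamespace false

noncomputable section

namespace Summit.ValiantsHypothesis.ValiantsHypothesis.Theorems.ProjectionStabilityOptStep.TransportSymm

open MvPolynomial Matrix
open scoped Kronecker
open Literature.Computability.AlgebraicComplexity

/-! ### A generic closure lemma -/

/-- Conjugation into a closure: if `t x t⁻¹ ∈ closure T` for every generator `x ∈ S`, then
`t x t⁻¹ ∈ closure T` for every `x ∈ closure S` (conjugation is a group homomorphism). [folklore] -/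
theorem conj_mem_closure {G : Type*} [Group G] {S T : Set G} (t : G)
    (h : ∀ x ∈ S, t * x * t⁻¹ ∈ Subgroup.closure T) {x : G} (hx : x ∈ Subgroup.closure S) :
    t * x * t⁻¹ ∈ Subgroup.closure T := by
  induction hx using Subgroup.closure_induction with
  | mem x hx => exact h x hx
  | one => rw [mul_one, mul_inv_cancel]; exact Subgroup.one_mem _
  | mul x y _ _ hx hy =>
    have e : t * (x * y) * t⁻¹ = t * x * t⁻¹ * (t * y * t⁻¹) := by group
    rw [e]; exact Subgroup.mul_mem _ hx hy
  | inv x _ hx =>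
    have e : t * x⁻¹ * t⁻¹ = (t * x * t⁻¹)⁻¹ := by group
    rw [e]; exact Subgroup.inv_mem _ hx

/-! ### The transposition substitution `τ` and the structure of `permSymmetrySubst` -/

section Group

variable {k : ℕ}

/-- `Prod.swap ∘ Prod.swap = id` as permutations of `Fin k × Fin k`. [folklore] -/
theorem swapPerm_mul_self :
    Equiv.prodComm (Fin k) (Fin k) * Equiv.prodComm (Fin k) (Fin k) =
      (1 : Equiv.Perm (Fin k × Fin k)) :=
  Equiv.ext fun x => by simp [Equiv.Perm.mul_apply]

/-- The permutation matrix of `Prod.swap` (the substitution `x ↦ xᵀ`) squares to `1`. [folklore] -/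
theorem swapPermMatrix_mul_self :
    Equiv.Perm.permMatrix ℂ (Equiv.prodComm (Fin k) (Fin k)) *
        Equiv.Perm.permMatrix ℂ (Equiv.prodComm (Fin k) (Fin k)) =
      (1 : Matrix (Fin k × Fin k) (Fin k × Fin k) ℂ) := by
  rw [← Matrix.permMatrix_mul, swapPerm_mul_self, Matrix.permMatrix_one]

/-- Conjugating a Kronecker product by the `Prod.swap` permutation matrix swaps the factors:
`τ (g ⊗ h) τ = h ⊗ g`. [folklore] -/
theorem swapPermMatrix_mul_kronecker_mul_swapPermMatrix (g h : Matrix (Fin k) (Fin k) ℂ) :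
    Equiv.Perm.permMatrix ℂ (Equiv.prodComm (Fin k) (Fin k)) * (g ⊗ₖ h) *
        Equiv.Perm.permMatrix ℂ (Equiv.prodComm (Fin k) (Fin k)) = h ⊗ₖ g := by
  rw [PEquiv.toMatrix_toPEquiv_mul, PEquiv.mul_toMatrix_toPEquiv]
  ext ⟨i, j⟩ ⟨i', j'⟩
  simp [mul_comm]

/-- The transposition substitution exists as an element of `GL(k²)`: `transposeSubstSet ℂ k` is
non-empty (the `ℤ₂` of `𝔾_{perm}`, Landsberg–Ressayre 2017, §2.1). [cite: LandsbergRessayre2017, §2.1] -/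
theorem exists_mem_transposeSubstSet :
    ∃ τ : GL (Fin k × Fin k) ℂ, τ ∈ transposeSubstSet ℂ k :=
  ⟨⟨_, _, swapPermMatrix_mul_self, swapPermMatrix_mul_self⟩, rfl⟩

variable {τ : GL (Fin k × Fin k) ℂ}

/-- The matrix of an element of `transposeSubstSet` (unfolding lemma). [folklore] -/
theorem coe_eq_of_mem_transposeSubstSet (hτ : τ ∈ transposeSubstSet ℂ k) :
    (τ : Matrix (Fin k × Fin k) (Fin k × Fin k) ℂ) =
      Equiv.Perm.permMatrix ℂ (Equiv.prodComm (Fin k) (Fin k)) := hτ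

/-- `τ² = 1`. [folklore] -/
theorem mul_self_of_mem_transposeSubstSet (hτ : τ ∈ transposeSubstSet ℂ k) : τ * τ = 1 :=
  Units.ext (by
    rw [Units.val_mul, coe_eq_of_mem_transposeSubstSet hτ, swapPermMatrix_mul_self, Units.val_one])

/-- `τ⁻¹ = τ`. [folklore] -/
theorem inv_eq_self_of_mem_transposeSubstSet (hτ : τ ∈ transposeSubstSet ℂ k) : τ⁻¹ = τ :=
  inv_eq_of_mul_eq_one_right (mul_self_of_mem_transposeSubstSet hτ)

/-- `transposeSubstSet ℂ k` has exactly one element. [folklore] -/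
theorem eq_of_mem_transposeSubstSet (hτ : τ ∈ transposeSubstSet ℂ k) {γ : GL (Fin k × Fin k) ℂ}
    (hγ : γ ∈ transposeSubstSet ℂ k) : γ = τ :=
  Units.ext ((coe_eq_of_mem_transposeSubstSet hγ).trans (coe_eq_of_mem_transposeSubstSet hτ).symm)

/-- The substitution `τ` is the renaming `x_{ij} ↦ x_{ji}` of the variables
(`linSubst_permMatrix`; `Prod.swap` is an involution). [folklore] -/
theorem linSubst_of_mem_transposeSubstSet (hτ : τ ∈ transposeSubstSet ℂ k) :
    linSubst (Fin k × Fin k) ℂ (τ : Matrix (Fin k × Fin k) (Fin k × Fin k) ℂ) = rename Prod.swap := by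
  rw [coe_eq_of_mem_transposeSubstSet hτ, linSubst_permMatrix, Equiv.prodComm_symm, Equiv.coe_prodComm]

/-- `M(τ·x) = M.map (rename Prod.swap)`: substituting `τ` is the variable-transpose. [folklore] -/
theorem linSubstEntries_of_mem_transposeSubstSet (hτ : τ ∈ transposeSubstSet ℂ k) {ι : Type*}
    (M : Matrix ι ι (MvPolynomial (Fin k × Fin k) ℂ)) :
    Matrix.linSubstEntries τ M = M.map (rename Prod.swap) := by
  rw [Matrix.linSubstEntries, linSubst_of_mem_transposeSubstSet hτ]

/-- `M(τ·x)(τ·x) = M`. [folklore] -/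
theorem linSubstEntries_linSubstEntries_of_mem_transposeSubstSet (hτ : τ ∈ transposeSubstSet ℂ k)
    {ι : Type*} (M : Matrix ι ι (MvPolynomial (Fin k × Fin k) ℂ)) :
    Matrix.linSubstEntries τ (Matrix.linSubstEntries τ M) = M := by
  rw [Matrix.linSubstEntries_linSubstEntries, mul_self_of_mem_transposeSubstSet hτ,
    Matrix.linSubstEntries_one]

/-- `τ` fixes the permanent: `per(xᵀ) = per(x)` (`Matrix.permanent_transpose`). [folklore] -/
theorem rename_swap_perPoly : rename Prod.swap (perPoly (Fin k) ℂ) = perPoly (Fin k) ℂ := by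
  have h : rename (Prod.swap : Fin k × Fin k → Fin k × Fin k) (perPoly (Fin k) ℂ) =
      ((Matrix.mvPolynomialX (Fin k) (Fin k) ℂ).transpose).permanent := by
    simp [perPoly, Matrix.permanent, map_sum, map_prod, Matrix.mvPolynomialX, rename_X]
  rw [h, Matrix.permanent_transpose]
  rfl

/-- **`L` and `R` commute elementwise**: `(g ⊗ 1)(1 ⊗ h) = g ⊗ h = (1 ⊗ h)(g ⊗ 1)` on generators
(`Matrix.mul_kronecker_mul`), extended to the closures (`Subgroup.centralizer_closure`)
(Landsberg–Ressayre 2017, §2.1: `N(T^{GL(E)}) × N(T^{GL(F)})` acts). [cite: LandsbergRessayre2017, §2.1] -/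
theorem rightMonomialSubst_le_centralizer :
    rightMonomialSubst ℂ k ≤
      Subgroup.centralizer (leftMonomialSubst ℂ k : Set (GL (Fin k × Fin k) ℂ)) := by
  unfold rightMonomialSubst leftMonomialSubst
  rw [Subgroup.centralizer_closure, Subgroup.closure_le]
  rintro x ⟨h, -, hx⟩
  rw [SetLike.mem_coe, Subgroup.mem_centralizer_iff]
  rintro y ⟨g, -, hy⟩
  apply Units.ext
  rw [Units.val_mul, Units.val_mul, hx, hy, ← Matrix.mul_kronecker_mul, ← Matrix.mul_kronecker_mul]
  simp only [Matrix.mul_one, Matrix.one_mul]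

/-- `ℓ r = r ℓ` for `ℓ ∈ L`, `r ∈ R`. [cite: LandsbergRessayre2017, §2.1] -/
theorem mul_comm_of_mem_left_right {ℓ r : GL (Fin k × Fin k) ℂ} (hℓ : ℓ ∈ leftMonomialSubst ℂ k)
    (hr : r ∈ rightMonomialSubst ℂ k) : ℓ * r = r * ℓ :=
  Subgroup.mem_centralizer_iff.1 (rightMonomialSubst_le_centralizer hr) ℓ hℓ

/-- **`τ L τ⁻¹ ⊆ R`**: `τ (g ⊗ 1) τ = 1 ⊗ g` on generators (Landsberg–Ressayre 2017, §2.1: the `ℤ₂`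
swaps `E` and `F`). [cite: LandsbergRessayre2017, §2.1] -/
theorem conj_mem_rightMonomialSubst (hτ : τ ∈ transposeSubstSet ℂ k) {ℓ : GL (Fin k × Fin k) ℂ}
    (hℓ : ℓ ∈ leftMonomialSubst ℂ k) : τ * ℓ * τ⁻¹ ∈ rightMonomialSubst ℂ k := by
  refine conj_mem_closure τ ?_ hℓ
  rintro x ⟨g, hg, hx⟩
  refine Subgroup.subset_closure ⟨g, hg, ?_⟩
  rw [inv_eq_self_of_mem_transposeSubstSet hτ, Units.val_mul, Units.val_mul, hx,
    coe_eq_of_mem_transposeSubstSet hτ, swapPermMatrix_mul_kronecker_mul_swapPermMatrix]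

/-- **`τ R τ⁻¹ ⊆ L`**: `τ (1 ⊗ h) τ = h ⊗ 1` on generators. [cite: LandsbergRessayre2017, §2.1] -/
theorem conj_mem_leftMonomialSubst (hτ : τ ∈ transposeSubstSet ℂ k) {r : GL (Fin k × Fin k) ℂ}
    (hr : r ∈ rightMonomialSubst ℂ k) : τ * r * τ⁻¹ ∈ leftMonomialSubst ℂ k := by
  refine conj_mem_closure τ ?_ hr
  rintro x ⟨h, hh, hx⟩
  refine Subgroup.subset_closure ⟨h, hh, ?_⟩
  rw [inv_eq_self_of_mem_transposeSubstSet hτ, Units.val_mul, Units.val_mul, hx,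
    coe_eq_of_mem_transposeSubstSet hτ, swapPermMatrix_mul_kronecker_mul_swapPermMatrix]

end Group

/-! ### Transport of exact `L`-lifts -/

section Transport

variable {k : ℕ} {ι : Type*} [Fintype ι] [DecidableEq ι]

/-- Gauge lifts of `Γ` survive substitution by any `δ` normalising `Γ`:
`(M(δ·x))(γ·x) = M((γδ)·x) = (M((δ⁻¹γδ)·x))(δ·x)` (the tree's
`forall_exists_lift_linSubstEntries` is the case `δ ∈ Γ`). [folklore] -/
theorem forall_exists_lift_linSubstEntries_of_conj_mem {Γ : Subgroup (GL (Fin k × Fin k) ℂ)}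
    {M : Matrix ι ι (MvPolynomial (Fin k × Fin k) ℂ)}
    (hM : ∀ γ ∈ Γ, ∃ P Q : GL ι ℂ, Matrix.linSubstEntries γ M =
      (P : Matrix ι ι ℂ).map C * M * (Q : Matrix ι ι ℂ).map C)
    {δ : GL (Fin k × Fin k) ℂ} (hδ : ∀ γ ∈ Γ, δ⁻¹ * γ * δ ∈ Γ) :
    ∀ γ ∈ Γ, ∃ P Q : GL ι ℂ,
      Matrix.linSubstEntries γ (Matrix.linSubstEntries δ M) =
        (P : Matrix ι ι ℂ).map C * Matrix.linSubstEntries δ M * (Q : Matrix ι ι ℂ).map C := by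
  intro γ hγ
  obtain ⟨P, Q, e⟩ := hM (δ⁻¹ * γ * δ) (hδ γ hγ)
  refine ⟨P, Q, ?_⟩
  have hconj : γ * δ = δ * (δ⁻¹ * γ * δ) := by group
  rw [Matrix.linSubstEntries_linSubstEntries, hconj, ← Matrix.linSubstEntries_linSubstEntries, e,
    Matrix.linSubstEntries_mul, Matrix.linSubstEntries_mul, Matrix.linSubstEntries_map_C,
    Matrix.linSubstEntries_map_C]

/-- `L`-lifts survive `M ↦ M(ℓ·x)`, `ℓ ∈ L`. [folklore] -/
theorem lifts_linSubstEntries_of_mem_left {M : Matrix ι ι (MvPolynomial (Fin k × Fin k) ℂ)}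
    (hM : ∀ γ ∈ leftMonomialSubst ℂ k, ∃ P Q : GL ι ℂ, Matrix.linSubstEntries γ M =
      (P : Matrix ι ι ℂ).map C * M * (Q : Matrix ι ι ℂ).map C)
    {ℓ : GL (Fin k × Fin k) ℂ} (hℓ : ℓ ∈ leftMonomialSubst ℂ k) :
    ∀ γ ∈ leftMonomialSubst ℂ k, ∃ P Q : GL ι ℂ,
      Matrix.linSubstEntries γ (Matrix.linSubstEntries ℓ M) =
        (P : Matrix ι ι ℂ).map C * Matrix.linSubstEntries ℓ M * (Q : Matrix ι ι ℂ).map C :=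
  forall_exists_lift_linSubstEntries hM hℓ

/-- `L`-lifts survive `M ↦ M(r·x)`, `r ∈ R` (`r` centralises `L`). [folklore] -/
theorem lifts_linSubstEntries_of_mem_right {M : Matrix ι ι (MvPolynomial (Fin k × Fin k) ℂ)}
    (hM : ∀ γ ∈ leftMonomialSubst ℂ k, ∃ P Q : GL ι ℂ, Matrix.linSubstEntries γ M =
      (P : Matrix ι ι ℂ).map C * M * (Q : Matrix ι ι ℂ).map C)
    {r : GL (Fin k × Fin k) ℂ} (hr : r ∈ rightMonomialSubst ℂ k) :
    ∀ γ ∈ leftMonomialSubst ℂ k, ∃ P Q : GL ι ℂ,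
      Matrix.linSubstEntries γ (Matrix.linSubstEntries r M) =
        (P : Matrix ι ι ℂ).map C * Matrix.linSubstEntries r M * (Q : Matrix ι ι ℂ).map C :=
  forall_exists_lift_linSubstEntries_of_conj_mem hM fun γ hγ => by
    rw [mul_assoc, mul_comm_of_mem_left_right hγ hr, inv_mul_cancel_left]
    exact hγ

variable {τ : GL (Fin k × Fin k) ℂ}

/-- Twisted transport along `ℓ ∈ L`: `M(ℓ·x)(τ·x) = M(τ·x)((τ ℓ τ⁻¹)·x)` with `τ ℓ τ⁻¹ ∈ R`.
[folklore] -/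
theorem lifts_swap_linSubstEntries_of_mem_left (hτ : τ ∈ transposeSubstSet ℂ k)
    {M : Matrix ι ι (MvPolynomial (Fin k × Fin k) ℂ)}
    (hM : ∀ γ ∈ leftMonomialSubst ℂ k, ∃ P Q : GL ι ℂ,
      Matrix.linSubstEntries γ (Matrix.linSubstEntries τ M) =
        (P : Matrix ι ι ℂ).map C * Matrix.linSubstEntries τ M * (Q : Matrix ι ι ℂ).map C)
    {ℓ : GL (Fin k × Fin k) ℂ} (hℓ : ℓ ∈ leftMonomialSubst ℂ k) :
    ∀ γ ∈ leftMonomialSubst ℂ k, ∃ P Q : GL ι ℂ,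
      Matrix.linSubstEntries γ (Matrix.linSubstEntries τ (Matrix.linSubstEntries ℓ M)) =
        (P : Matrix ι ι ℂ).map C * Matrix.linSubstEntries τ (Matrix.linSubstEntries ℓ M) *
          (Q : Matrix ι ι ℂ).map C := by
  have e : Matrix.linSubstEntries τ (Matrix.linSubstEntries ℓ M) =
      Matrix.linSubstEntries (τ * ℓ * τ⁻¹) (Matrix.linSubstEntries τ M) := by
    rw [Matrix.linSubstEntries_linSubstEntries, Matrix.linSubstEntries_linSubstEntries,
      inv_mul_cancel_right]
  rw [e]
  exact lifts_linSubstEntries_of_mem_right hM (conj_mem_rightMonomialSubst hτ hℓ)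

/-- Twisted transport along `r ∈ R`: `M(r·x)(τ·x) = M(τ·x)((τ r τ⁻¹)·x)` with `τ r τ⁻¹ ∈ L`.
[folklore] -/
theorem lifts_swap_linSubstEntries_of_mem_right (hτ : τ ∈ transposeSubstSet ℂ k)
    {M : Matrix ι ι (MvPolynomial (Fin k × Fin k) ℂ)}
    (hM : ∀ γ ∈ leftMonomialSubst ℂ k, ∃ P Q : GL ι ℂ,
      Matrix.linSubstEntries γ (Matrix.linSubstEntries τ M) =
        (P : Matrix ι ι ℂ).map C * Matrix.linSubstEntries τ M * (Q : Matrix ι ι ℂ).map C)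
    {r : GL (Fin k × Fin k) ℂ} (hr : r ∈ rightMonomialSubst ℂ k) :
    ∀ γ ∈ leftMonomialSubst ℂ k, ∃ P Q : GL ι ℂ,
      Matrix.linSubstEntries γ (Matrix.linSubstEntries τ (Matrix.linSubstEntries r M)) =
        (P : Matrix ι ι ℂ).map C * Matrix.linSubstEntries τ (Matrix.linSubstEntries r M) *
          (Q : Matrix ι ι ℂ).map C := by
  have e : Matrix.linSubstEntries τ (Matrix.linSubstEntries r M) =
      Matrix.linSubstEntries (τ * r * τ⁻¹) (Matrix.linSubstEntries τ M) := by
    rw [Matrix.linSubstEntries_linSubstEntries, Matrix.linSubstEntries_linSubstEntries,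
      inv_mul_cancel_right]
  rw [e]
  exact lifts_linSubstEntries_of_mem_left hM (conj_mem_leftMonomialSubst hτ hr)

/-- **Every realised symmetry of `per_k` preserves half-liftability.** If `M` or `M(τ·x)` is
`L`-liftable and `γ ∈ permSymmetrySubst ℂ k`, then `M(γ·x)` or `M(γ·x)(τ·x)` is `L`-liftable
(closure induction over `S = closure (L ∪ R ∪ {τ})`: `ℓ ∈ L` and `r ∈ R` preserve each disjunct,
`τ` swaps them; Landsberg–Ressayre 2017, §2.1 for the structure of `𝔾_{perm}`). [cite: LandsbergRessayre2017, §2.1] -/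
theorem halfLifts_linSubstEntries (hτ : τ ∈ transposeSubstSet ℂ k) {γ : GL (Fin k × Fin k) ℂ}
    (hγ : γ ∈ permSymmetrySubst ℂ k) :
    ∀ M : Matrix ι ι (MvPolynomial (Fin k × Fin k) ℂ),
      ((∀ δ ∈ leftMonomialSubst ℂ k, ∃ P Q : GL ι ℂ, Matrix.linSubstEntries δ M =
          (P : Matrix ι ι ℂ).map C * M * (Q : Matrix ι ι ℂ).map C) ∨
        (∀ δ ∈ leftMonomialSubst ℂ k, ∃ P Q : GL ι ℂ,
          Matrix.linSubstEntries δ (Matrix.linSubstEntries τ M) =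
            (P : Matrix ι ι ℂ).map C * Matrix.linSubstEntries τ M * (Q : Matrix ι ι ℂ).map C)) →
      ((∀ δ ∈ leftMonomialSubst ℂ k, ∃ P Q : GL ι ℂ,
          Matrix.linSubstEntries δ (Matrix.linSubstEntries γ M) =
            (P : Matrix ι ι ℂ).map C * Matrix.linSubstEntries γ M * (Q : Matrix ι ι ℂ).map C) ∨
        (∀ δ ∈ leftMonomialSubst ℂ k, ∃ P Q : GL ι ℂ,
          Matrix.linSubstEntries δ (Matrix.linSubstEntries τ (Matrix.linSubstEntries γ M)) =
            (P : Matrix ι ι ℂ).map C * Matrix.linSubstEntries τ (Matrix.linSubstEntries γ M) *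
              (Q : Matrix ι ι ℂ).map C)) := by
  induction hγ using Subgroup.closure_induction'' with
  | mem x hx =>
    intro M hM
    rcases hx with (hx | hx) | hx
    · exact hM.imp (fun h => lifts_linSubstEntries_of_mem_left h hx)
        (fun h => lifts_swap_linSubstEntries_of_mem_left hτ h hx)
    · exact hM.imp (fun h => lifts_linSubstEntries_of_mem_right h hx)
        (fun h => lifts_swap_linSubstEntries_of_mem_right hτ h hx)
    · rw [eq_of_mem_transposeSubstSet hτ hx]
      refine hM.symm.imp id fun h => ?_
      rwa [linSubstEntries_linSubstEntries_of_mem_transposeSubstSet hτ]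
  | inv_mem x hx =>
    intro M hM
    rcases hx with (hx | hx) | hx
    · exact hM.imp (fun h => lifts_linSubstEntries_of_mem_left h (Subgroup.inv_mem _ hx))
        (fun h => lifts_swap_linSubstEntries_of_mem_left hτ h (Subgroup.inv_mem _ hx))
    · exact hM.imp (fun h => lifts_linSubstEntries_of_mem_right h (Subgroup.inv_mem _ hx))
        (fun h => lifts_swap_linSubstEntries_of_mem_right hτ h (Subgroup.inv_mem _ hx))
    · rw [eq_of_mem_transposeSubstSet hτ hx, inv_eq_self_of_mem_transposeSubstSet hτ]
      refine hM.symm.imp id fun h => ?_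
      rwa [linSubstEntries_linSubstEntries_of_mem_transposeSubstSet hτ]
  | one =>
    intro M hM
    rwa [Matrix.linSubstEntries_one]
  | mul x y _ _ hx hy =>
    intro M hM
    rw [← Matrix.linSubstEntries_linSubstEntries]
    exact hx _ (hy _ hM)

end Transport

/-! ### The registered stub -/

/-- **S6 — transport of half-equivariance along the realised symmetries of `per_k`.**
If `A` (or its variable-transpose `A.map (rename Prod.swap)`) is an exactly-lifted
`leftMonomialSubst`-equivariant affine determinantal representation of `per_k` and
`γ ∈ permSymmetrySubst ℂ k`, then `A(γ·x)` (or its variable-transpose) is one too, provided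
`det A(γ·x) = per_k`. Structure used: `permSymmetrySubst = closure (L ∪ R ∪ {τ})` with
`L = leftMonomialSubst`, `R = rightMonomialSubst` commuting elementwise, `τ` the `Prod.swap`
permutation matrix, `τ L τ⁻¹ = R`, and `A(τ·x) = A.map (rename Prod.swap)`; an `L`-liftable `A`
stays `L`-liftable under `ℓ ∈ L` (lift) and `r ∈ R` (commutation), and `τ` swaps the two
disjuncts (`halfLifts_linSubstEntries`); the determinant is restored at the end from the
hypothesis, with `rename Prod.swap per_k = per_k`. [cite: LandsbergRessayre2017, §2.1, Def. 1.3] -/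
theorem stub_halfEq_transport_symm :
    ∀ (k m : ℕ) (A : Matrix (Fin m) (Fin m) (MvPolynomial (Fin k × Fin k) ℂ)) (γ : GL (Fin k × Fin k) ℂ),
      γ ∈ permSymmetrySubst ℂ k →
      (IsEquivariantDetRepr (leftMonomialSubst ℂ k) (perPoly (Fin k) ℂ) A ∨
        IsEquivariantDetRepr (leftMonomialSubst ℂ k) (perPoly (Fin k) ℂ) (A.map (rename Prod.swap))) →
      (Matrix.linSubstEntries γ A).det = perPoly (Fin k) ℂ →
      (IsEquivariantDetRepr (leftMonomialSubst ℂ k) (perPoly (Fin k) ℂ) (Matrix.linSubstEntries γ A) ∨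
        IsEquivariantDetRepr (leftMonomialSubst ℂ k) (perPoly (Fin k) ℂ)
          ((Matrix.linSubstEntries γ A).map (rename Prod.swap))) := by
  intro k m A γ hγ hA hdet
  obtain ⟨τ, hτ⟩ := exists_mem_transposeSubstSet (k := k)
  rw [← linSubstEntries_of_mem_transposeSubstSet hτ A] at hA
  rw [← linSubstEntries_of_mem_transposeSubstSet hτ (Matrix.linSubstEntries γ A)]
  simp only [isEquivariantDetRepr_iff_exists_mul_mul] at hA ⊢
  -- the entries of `A` are affine in both cases (`A = A(τ·x)(τ·x)`)
  have hdeg : ∀ i j, (A i j).totalDegree ≤ 1 := by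
    rcases hA with ⟨⟨h, -⟩, -⟩ | ⟨⟨h, -⟩, -⟩
    · exact h
    · have h' : ∀ i j, ((Matrix.linSubstEntries τ (Matrix.linSubstEntries τ A)) i j).totalDegree ≤ 1 :=
        totalDegree_linSubstEntries_le τ h
      rwa [linSubstEntries_linSubstEntries_of_mem_transposeSubstSet hτ] at h'
  have hdegB : ∀ i j, ((Matrix.linSubstEntries γ A) i j).totalDegree ≤ 1 :=
    totalDegree_linSubstEntries_le γ hdeg
  -- transport the half-lifts along `γ`
  rcases halfLifts_linSubstEntries hτ hγ A (hA.imp (fun h => h.2) fun h => h.2) with h | h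
  · exact Or.inl ⟨⟨hdegB, hdet⟩, h⟩
  · refine Or.inr ⟨⟨totalDegree_linSubstEntries_le τ hdegB, ?_⟩, h⟩
    rw [det_linSubstEntries, hdet, linSubst_of_mem_transposeSubstSet hτ]
    exact rename_swap_perPoly

end Summit.ValiantsHypothesis.ValiantsHypothesis.Theorems.ProjectionStabilityOptStep.TransportSymm

end
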